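import Mathlib.NumberTheory.NumberField.Discriminant.Different
import Mathlib.NumberTheory.NumberField.Discriminant.Basic
import Mathlib.RingTheory.RamificationInertia.Basic
import HarnessLib

/-!
# An extension of an odd-degree number field that is unramified at all finite primes has no
# quadratic subfield

Topic `Literature/NumberTheory/NumberFields`, namespace `Literature.NumberTheory.NumberFields`.
Theorem-only file (no definition, no named fact).

* `finrank_ne_two_of_forall_isUnramifiedAt_of_odd` — let `K` be a number field of ODD degree and
  `E/K` a finite extension in which every maximal ideal of `𝓞 E` is unramified over `𝓞 K`.  Then `E`
  (as a number field over `ℚ`) contains no subfield of degree `2` over `ℚ`.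

Proof.  Let `F ⊆ E` be quadratic over `ℚ`.  By Minkowski `|d_F| > 1`, so some rational prime `p`
divides `d_F` and ramifies in `F` (Dedekind's discriminant theorem, Mathlib
`NumberField.not_dvd_discr_iff_isUnramifiedIn`); as `[F:ℚ] = 2 = Σ e f`, the prime `𝔮` of `F` above
`p` is unique with `e(𝔮|p) = 2`.  For a prime `𝔭` of `K` above `p` pick a prime `𝔓` of `E` above `𝔭`;
then `e(𝔓|p) = e(𝔭|p)·e(𝔓|𝔭) = e(𝔭|p)` (`E/K` unramified) and `e(𝔓|p) = e(𝔮|p)·e(𝔓|𝔮) = 2e(𝔓|𝔮)`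
(multiplicativity in towers, Mathlib `Ideal.ramificationIdx_tower`), so every `e(𝔭|p)` is even and
`[K:ℚ] = Σ_{𝔭∣p} e(𝔭|p) f(𝔭|p)` is even — a contradiction.  This is the mechanism behind "a number
field of odd degree admits no everywhere unramified extension containing a quadratic field"; it is
used (route QuantumAdvantage/LinnikCubicClassGroups) to show that the class fields of the real
class group characters of an odd-degree field have no quadratic subfield, so that Stark's theorem
excludes their exceptional zeros.

## References

* J. Neukirch, *Algebraic Number Theory* (1999), Ch. I (8.2) (fundamental identity `Σ eᵢfᵢ = n`),
  Ch. II (9.?)/III (2.6), (2.12) (ramification and the discriminant; Minkowski: `|d_F| > 1`).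
  [NeukirchANT1999]
* H. M. Stark, *Some effective cases of the Brauer–Siegel theorem*, Invent. Math. 23 (1974),
  Thm. 3 (the application). [Stark1974]
-/

namespace Literature.NumberTheory.NumberFields

open NumberField Ideal Module

/-- In a quadratic number field, a rational prime dividing the discriminant has a UNIQUE prime
above it, with ramification index `2`: every prime `𝔮` of `𝓞 F` over `p ∣ d_F` has `e(𝔮|p) = 2`.
[folklore] -/
theorem ramificationIdx_eq_two_of_dvd_discr_of_finrank_eq_two {F : Type*} [Field F] [NumberField F]
    (hF : finrank ℚ F = 2) {p : ℤ} (hp : Prime p) (hdvd : p ∣ discr F)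
    (𝔮 : Ideal (𝓞 F)) [𝔮.IsMaximal] [h𝔮 : 𝔮.LiesOver (Ideal.span {p})] :
    𝔮.ramificationIdx ℤ = 2 := by
  classical
  haveI hpmax : (Ideal.span {p}).IsMaximal :=
    ((Ideal.span_singleton_prime hp.ne_zero).mpr hp).isMaximal
      (by rw [Ne, Ideal.span_singleton_eq_bot]; exact hp.ne_zero)
  -- some prime over `p` is ramified
  have hram : ¬ Algebra.IsUnramifiedIn (𝓞 F) (Ideal.span {p}) := fun h =>
    (NumberField.not_dvd_discr_iff_isUnramifiedIn F (𝓞 F) hp).mpr h hdvd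
  rw [Algebra.isUnramifiedIn_iff_forall_of_isDedekindDomain] at hram
  push Not at hram
  obtain ⟨𝔮₀, h𝔮₀max, h𝔮₀over, h𝔮₀ram⟩ := hram
  haveI := h𝔮₀max
  haveI := h𝔮₀over
  have he₀ : 𝔮₀.ramificationIdx ℤ ≠ 1 := fun h1 =>
    h𝔮₀ram (Ideal.ramificationIdx_eq_one_iff.mp h1)
  have he₀pos : 0 < 𝔮₀.ramificationIdx ℤ := Ideal.ramificationIdx_pos 𝔮₀ ℤ
  have hf₀pos : 0 < 𝔮₀.inertiaDeg ℤ := Ideal.inertiaDeg_pos 𝔮₀ ℤ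
  -- the fundamental identity `Σ e f = 2`
  have hsum := Ideal.sum_ramification_inertia_eq_finrank (Ideal.span {p}) (𝓞 F)
  rw [NumberField.RingOfIntegers.rank, hF] at hsum
  -- split off the term of `𝔮₀`
  have hmem₀ : (⟨𝔮₀, h𝔮₀max.isPrime, h𝔮₀over⟩ : (Ideal.span {p}).primesOver (𝓞 F)) ∈
      (Finset.univ : Finset ((Ideal.span {p}).primesOver (𝓞 F))) := Finset.mem_univ _
  rw [← Finset.add_sum_erase _ _ hmem₀] at hsum
  have hterm₀ : 2 ≤ 𝔮₀.ramificationIdx ℤ * 𝔮₀.inertiaDeg ℤ := by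
    have : 2 ≤ 𝔮₀.ramificationIdx ℤ := by omega
    nlinarith
  -- hence the remaining sum vanishes: `𝔮₀` is the only prime over `p`, and `e(𝔮₀|p) f = 2`
  have hrest : ∑ x ∈ Finset.univ.erase (⟨𝔮₀, h𝔮₀max.isPrime, h𝔮₀over⟩ :
      (Ideal.span {p}).primesOver (𝓞 F)), x.1.ramificationIdx ℤ * x.1.inertiaDeg ℤ = 0 := by
    simp only at hsum
    omega
  have hmem : (⟨𝔮, ‹𝔮.IsMaximal›.isPrime, h𝔮⟩ : (Ideal.span {p}).primesOver (𝓞 F)) =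
      ⟨𝔮₀, h𝔮₀max.isPrime, h𝔮₀over⟩ := by
    by_contra hne
    have hin : (⟨𝔮, ‹𝔮.IsMaximal›.isPrime, h𝔮⟩ : (Ideal.span {p}).primesOver (𝓞 F)) ∈
        Finset.univ.erase (⟨𝔮₀, h𝔮₀max.isPrime, h𝔮₀over⟩ : (Ideal.span {p}).primesOver (𝓞 F)) :=
      Finset.mem_erase.mpr ⟨hne, Finset.mem_univ _⟩
    have hle := Finset.single_le_sum (f := fun x : (Ideal.span {p}).primesOver (𝓞 F) =>
      x.1.ramificationIdx ℤ * x.1.inertiaDeg ℤ) (fun _ _ => Nat.zero_le _) hin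
    rw [hrest] at hle
    have h1 : 0 < 𝔮.ramificationIdx ℤ * 𝔮.inertiaDeg ℤ :=
      Nat.mul_pos (Ideal.ramificationIdx_pos 𝔮 ℤ) (Ideal.inertiaDeg_pos 𝔮 ℤ)
    simp only at hle
    omega
  have h𝔮eq : 𝔮 = 𝔮₀ := congrArg Subtype.val hmem
  subst h𝔮eq
  -- `e f = 2` with `e ≥ 2`, `f ≥ 1`
  simp only at hsum
  have hprod : 𝔮.ramificationIdx ℤ * 𝔮.inertiaDeg ℤ = 2 := by omega
  have hle2 : 𝔮.ramificationIdx ℤ ≤ 2 := by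
    calc 𝔮.ramificationIdx ℤ ≤ 𝔮.ramificationIdx ℤ * 𝔮.inertiaDeg ℤ :=
          Nat.le_mul_of_pos_right _ hf₀pos
      _ = 2 := hprod
  omega

/-- **An extension, unramified at all finite primes, of a number field of odd degree contains no
quadratic subfield.**  Let `K` have odd degree over `ℚ` and let `E ⊇ K` be a number field in which
every maximal ideal of `𝓞 E` is unramified over `𝓞 K`.  Then no intermediate field of `E/ℚ` has
degree `2` over `ℚ`.  (If `F ⊆ E` were quadratic, a prime `p ∣ d_F` would have even ramification
index at every prime of `E` above it, hence at every prime of `K` above it, and `[K:ℚ] = Σ e f`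
would be even.) [folklore] -/
theorem finrank_ne_two_of_forall_isUnramifiedAt_of_odd {K E : Type*} [Field K] [NumberField K]
    [Field E] [NumberField E] [Algebra K E]
    (hodd : Odd (finrank ℚ K))
    (hunr : ∀ (P : Ideal (𝓞 E)) [P.IsMaximal], Algebra.IsUnramifiedAt (𝓞 K) P) :
    ∀ F : IntermediateField ℚ E, finrank ℚ F ≠ 2 := by
  classical
  intro F hF
  -- a ramified rational prime of the quadratic field `F`
  have hd : 2 < |discr F| := NumberField.abs_discr_gt_two (by rw [hF]; norm_num)
  set p : ℕ := (discr F).natAbs.minFac with hpdef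
  have hd1 : (discr F).natAbs ≠ 1 := by
    intro h
    have : |discr F| = 1 := by rw [Int.abs_eq_natAbs, h]; norm_num
    omega
  have hpnat : p.Prime := Nat.minFac_prime hd1
  have hp : Prime (p : ℤ) := Nat.prime_iff_prime_int.mp hpnat
  have hpdvd : (p : ℤ) ∣ discr F := by
    rw [← Int.dvd_natAbs, Int.natCast_dvd_natCast]
    exact Nat.minFac_dvd _
  haveI hpmax : (Ideal.span {(p : ℤ)}).IsMaximal :=
    ((Ideal.span_singleton_prime hp.ne_zero).mpr hp).isMaximal
      (by rw [Ne, Ideal.span_singleton_eq_bot]; exact hp.ne_zero)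
  -- every prime of `K` above `p` has even ramification index
  have heven : ∀ 𝔭 : (Ideal.span {(p : ℤ)}).primesOver (𝓞 K), Even (𝔭.1.ramificationIdx ℤ) := by
    intro 𝔭
    haveI : 𝔭.1.IsPrime := 𝔭.2.1
    haveI : 𝔭.1.LiesOver (Ideal.span {(p : ℤ)}) := 𝔭.2.2
    haveI h𝔭max : 𝔭.1.IsMaximal := Ideal.IsMaximal.of_liesOver_isMaximal 𝔭.1 (Ideal.span {(p : ℤ)})
    -- a prime `𝔓` of `E` above `𝔭`
    obtain ⟨𝔓, h𝔓max, h𝔓over⟩ := Ideal.exists_maximal_ideal_liesOver_of_isIntegral (S := 𝓞 E) 𝔭.1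
    haveI := h𝔓max
    haveI := h𝔓over
    haveI : Algebra.IsUnramifiedAt (𝓞 K) 𝔓 := hunr 𝔓
    -- `e(𝔓|p) = e(𝔭|p) e(𝔓|𝔭) = e(𝔭|p)`
    have h1 : 𝔓.ramificationIdx (𝓞 K) = 1 := Ideal.ramificationIdx_eq_one 𝔓 (𝓞 K)
    have htowK := Ideal.ramificationIdx_tower (R := ℤ) 𝔭.1 𝔓
    rw [h1, mul_one] at htowK
    -- `e(𝔓|p) = e(𝔮|p) e(𝔓|𝔮) = 2 e(𝔓|𝔮)` for `𝔮 = 𝔓 ∩ F`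
    haveI : (𝔓.under (𝓞 F)).IsMaximal := Ideal.IsMaximal.under (𝓞 F) 𝔓
    haveI : 𝔓.LiesOver (𝔓.under (𝓞 F)) := ⟨rfl⟩
    haveI h𝔓p : 𝔓.LiesOver (Ideal.span {(p : ℤ)}) := Ideal.LiesOver.trans 𝔓 𝔭.1 (Ideal.span {(p : ℤ)})
    haveI : (𝔓.under (𝓞 F)).LiesOver (Ideal.span {(p : ℤ)}) := by
      constructor
      rw [Ideal.under_under]
      exact h𝔓p.over
    have h2 : (𝔓.under (𝓞 F)).ramificationIdx ℤ = 2 :=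
      ramificationIdx_eq_two_of_dvd_discr_of_finrank_eq_two hF hp hpdvd (𝔓.under (𝓞 F))
    have htowF := Ideal.ramificationIdx_tower (R := ℤ) (𝔓.under (𝓞 F)) 𝔓
    rw [h2] at htowF
    rw [← htowK, htowF]
    exact even_two_mul _
  -- the fundamental identity for `K/ℚ` at `p` gives an even degree
  have hsum := Ideal.sum_ramification_inertia_eq_finrank (Ideal.span {(p : ℤ)}) (𝓞 K)
  rw [NumberField.RingOfIntegers.rank] at hsum
  have hev : Even (finrank ℚ K) := by
    rw [← hsum]
    exact Finset.even_sum _ fun 𝔭 _ => (heven 𝔭).mul_right _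
  exact (Nat.not_even_iff_odd.mpr hodd) hev

end Literature.NumberTheory.NumberFields
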